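import Summits.QuantumFields.YangMills.Theorems.BalabanUVNodesN21GappedTopCut13CoPHDefs

/-!
# N21 (NE7c) · THE GAPPED TOP CUT, TERM LEVEL: the TWO-SIDED COVER (a top-lettered term minus its gapped core is dominated by the COLLAR COUNT times the term, label by
# label, through def-T's resummation), the term ∕ core ∕ shell ON THE GRAPH of Bałaban's averaging (def-T's disintegration identity), and the sum over histories under the
# unity law: `Σ_{s′} gapShell(s′) ≤ ∫ collar(Ū)·ρ̃_k(U) dU` — at NODE 00's generality `ϑ D g₀ os p g k`

R134 seat `pub-ymgap-dag-n21-d` (g11), node N21 = NE7c (NOT PRINTED; NOT proved at print's fixed thresholds), strategy s2; lane K3⁷ `SpineGivenEndpointR13SepCoPH`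
(stmt-QuantumFields-20544, `--supports … --as helper`; COUNT-NEUTRAL).  Imports the definition lane `…N21GappedTopCut13CoPHDefs` (`aGapAt`, `wGapAt`, `topGapSlotAt`,
`topGapCoreAt`, `topGapShellAt`, `collarAt`; through it T1∕T2 and def-T FILE 19 ∕ FILE 2 ∕ FILE 1: `front_absorb_at`, `resumWeights`, `integral_transport_piece`,
`IsStepUnity`, `isStepUnity_wTopAt`).  Sequel (the pigeonhole over a grid of collars, the common depth of two runs, the record): `…N21GappedTopCut13CoPHCount`.

WHAT THIS FILE PROVES (theorems only; 0 `def`, 0 `sorry`; [folklore] finite products ∕ sums and the tree's disintegration identity BY NAME).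
* §29 GENERIC: for `{0,1}`-valued families `lo ≤ mid ≤ hi` on a finite type and disjoint `S`, `P`: `G := Π_S lo · Π_P (1 − hi) ≤ T := Π_S mid · Π_P (1 − mid)` and
  ★ `T − G ≤ (Σ_c (hi_c − lo_c)) · T` (`prod_gap_le_prod`, `prod_sub_prod_gap_le_collar_mul`) — the algebra of «no factor in the collar».
* §30 AT NODE 00's (3.2) WEIGHTS: ★ `aWeightAt_sub_aGapAt_le_collar_mul` (`a|_θ(P) − aGap(θlo,θhi)(P) ≤ collar(θlo,θhi)·a|_θ(P)`, `θlo ≤ θ ≤ θhi`); through def-T's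
  resummation and the two front-factor absorptions, pointwise in `(U, V′)` for every level-`(k+1)` history at the top `k + 1 = p.K`: ★★ `chi_mul_wGapAt_le_chi_mul_wTopAt`
  and ★★ `chi_mul_wTopAt_sub_chi_mul_wGapAt_le_collar_mul`.
* §31 ON THE GRAPH: `integral_mul_tstepOfRecordAt_eq_graph` (def-T FILE 1 `integral_transport_piece`: `∫ φ(V′)·(𝐓-step)(s′)(V′) dV′ = ∫ h_{s′}(U)·w(s′)(U,Ū)·φ(Ū) dU`), hence
  `topClassWeightAt_eq_graph`, `topGapCoreAt_eq_graph`, ★ `topGapShellAt_eq_graph`; (R) ★ `topGapShellAt_nonneg` (with the definition lane's `topGapShellAt_le_topClassWeightAt`: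
  `0 ≤ shell ≤ term`), ★ `topGapShellAt_le_graph_collar`.
* §32 ★★ `sum_topGapShellAt_le_integral_collar` — `Σ_{s′} gapShell^{θlo,θ,θhi}(s′) ≤ ∫ collar(θlo,θhi)(Ū) · Σ_s χ_k(s)(U)·slot_k(s)(U) dU`: the unity law of the top-lettered
  step weights ON THE GRAPH (`isStepUnity_wTopAt`) resolves the sum over the top histories.

HONEST FRAMING (binding).  [folklore] bookkeeping over NODE 00's objects of record; NO estimate of Bałaban's asserted or used; only the top step's (2.17)∕(3.2) family is
re-lettered; the common-refinement inequality of design (i) is the CONSUMER's; no lettered spine READING typed here; no `Provisos` inhabitant claimed (K0⁷ open); NE7c NOT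
PRINTED ∕ NOT proved at print's thresholds; N21 NOT discharged; K3⁷ NOT claimed; counts UNMOVED (typed 28∕28 · discharged 5∕27); never a count claim.  No `instance`, no
`notation`, no `def`.  One finite four-torus programme at fixed `ε` — NOT ℝ⁴, NOT OS, NOT a mass gap, NOT the Clay problem.
-/

noncomputable section

open scoped BigOperators
open Finset MeasureTheory

namespace Summit.QuantumFields.YangMills.Theorems.N21ShellSplitOfRecord13CoPH

open Literature.MathematicalPhysics.QuantumFieldTheory.Balaban1983to89
open Literature.MathematicalPhysics.QuantumFieldTheory.Balaban1983to89.T4Continuum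
open Literature.MathematicalPhysics.QuantumFieldTheory.Balaban1983to89.Node00
open Summit.QuantumFields.YangMills.BalabanUVNodes.N19MGFRoadLiveSelectorTower (dressedSlotsOfDatum₉_nonneg)
open Summit.QuantumFields.YangMills.BalabanUVNodes.N19MGFFormAtRecord (wOfRecord₉_nonneg)
open Literature.Probability.MarkovChains (one_sub_prod_le_sum_one_sub)

/-! ## §29 Generic: «no factor in the collar» — the gapped product against the one-letter product -/

section Generic

variable {ι : Type*} {S P : Finset ι} {lo mid hi : ι → ℝ}

/-- a real with `x·x = x` is `0` or `1`. [folklore] -/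
theorem eq_zero_or_one_of_mul_self {x : ℝ} (hx : x * x = x) : x = 0 ∨ x = 1 := by
  have h : x * (x - 1) = 0 := by rw [mul_sub, mul_one, hx, sub_self]
  rcases mul_eq_zero.mp h with h0 | h1
  · exact Or.inl h0
  · exact Or.inr (by linarith)

/-- a `{0,1}`-valued real below a number `y ≤ 1` satisfies `y·x = x`. [folklore] -/
theorem mul_eq_of_idem_of_le {x y : ℝ} (hx : x * x = x) (hxy : x ≤ y) (hy : y ≤ 1) : y * x = x := by
  rcases eq_zero_or_one_of_mul_self hx with h | h
  · rw [h, mul_zero]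
  · rw [h] at hxy ⊢; rw [mul_one]; exact le_antisymm hy hxy

/-- **THE GAPPED PRODUCT IS BELOW THE ONE-LETTER PRODUCT**: `Π_S lo · Π_P (1 − hi) ≤ Π_S mid · Π_P (1 − mid)` for `0 ≤ lo ≤ mid ≤ hi ≤ 1`. [folklore] -/
theorem prod_gap_le_prod (hlo0 : ∀ c, 0 ≤ lo c) (hlm : ∀ c, lo c ≤ mid c) (hmh : ∀ c, mid c ≤ hi c) (hhi1 : ∀ c, hi c ≤ 1) :
    (∏ c ∈ S, lo c) * ∏ c ∈ P, (1 - hi c) ≤ (∏ c ∈ S, mid c) * ∏ c ∈ P, (1 - mid c) :=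
  mul_le_mul (Finset.prod_le_prod (fun c _ => hlo0 c) fun c _ => hlm c)
    (Finset.prod_le_prod (fun c _ => sub_nonneg.2 (hhi1 c)) fun c _ => sub_le_sub_left (hmh c) 1)
    (Finset.prod_nonneg fun c _ => sub_nonneg.2 (hhi1 c))
    (Finset.prod_nonneg fun c _ => (hlo0 c).trans (hlm c))

/-- ★ **«NO FACTOR IN THE COLLAR»**: `T − G ≤ (Σ_c (hi_c − lo_c)) · T` for the one-letter product `T = Π_S mid · Π_P (1 − mid)` and the gapped product
`G = Π_S lo · Π_P (1 − hi)`, `S ∩ P = ∅`, `{0,1}`-valued `lo ≤ mid ≤ hi`.  Proof: `T − G ≤ T(1 − G)`; `1 − G ≤ Σ_S (1 − lo) + Σ_P hi` (Weierstrass); `T` is unchanged by one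
more factor `mid_c` (`c ∈ S`) or `1 − mid_c` (`c ∈ P`), so `T(1 − lo_c) = T(mid_c − lo_c)` and `T·hi_c = T(hi_c − mid_c)`. [folklore] -/
theorem prod_sub_prod_gap_le_collar_mul [Fintype ι] [DecidableEq ι] (hSP : Disjoint S P) (hlo0 : ∀ c, 0 ≤ lo c) (hlm : ∀ c, lo c ≤ mid c) (hmh : ∀ c, mid c ≤ hi c)
    (hhi1 : ∀ c, hi c ≤ 1) (hlo2 : ∀ c, lo c * lo c = lo c) (hmid2 : ∀ c, mid c * mid c = mid c) :
    (∏ c ∈ S, mid c) * ∏ c ∈ P, (1 - mid c) - (∏ c ∈ S, lo c) * ∏ c ∈ P, (1 - hi c) ≤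
      (∑ c, (hi c - lo c)) * ((∏ c ∈ S, mid c) * ∏ c ∈ P, (1 - mid c)) := by
  set T : ℝ := (∏ c ∈ S, mid c) * ∏ c ∈ P, (1 - mid c) with hT
  set G : ℝ := (∏ c ∈ S, lo c) * ∏ c ∈ P, (1 - hi c) with hG
  have hmid0 : ∀ c, 0 ≤ mid c := fun c => (hlo0 c).trans (hlm c)
  have hmid1 : ∀ c, mid c ≤ 1 := fun c => (hmh c).trans (hhi1 c)
  have hhi0 : ∀ c, 0 ≤ hi c := fun c => (hmid0 c).trans (hmh c)
  have hlo1 : ∀ c, lo c ≤ 1 := fun c => (hlm c).trans (hmid1 c)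
  have hT0 : 0 ≤ T := mul_nonneg (Finset.prod_nonneg fun c _ => hmid0 c) (Finset.prod_nonneg fun c _ => sub_nonneg.2 (hmid1 c))
  have hT1 : T ≤ 1 :=
    mul_le_one₀ (Finset.prod_le_one (fun c _ => hmid0 c) fun c _ => hmid1 c) (Finset.prod_nonneg fun c _ => sub_nonneg.2 (hmid1 c))
      (Finset.prod_le_one (fun c _ => sub_nonneg.2 (hmid1 c)) fun c _ => sub_le_self _ (hmid0 c))
  have hG0 : 0 ≤ G := mul_nonneg (Finset.prod_nonneg fun c _ => hlo0 c) (Finset.prod_nonneg fun c _ => sub_nonneg.2 (hhi1 c))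
  -- step 1: `T − G ≤ T (1 − G)`
  have h1 : T - G ≤ T * (1 - G) := by nlinarith [mul_nonneg hG0 (sub_nonneg.2 hT1)]
  -- step 2: Weierstrass on the gapped product
  have h2 : 1 - G ≤ ∑ c ∈ S, (1 - lo c) + ∑ c ∈ P, hi c := by
    have ha := one_sub_prod_le_sum_one_sub S (a := lo) (fun c _ => hlo0 c) fun c _ => hlo1 c
    have hb := one_sub_prod_le_sum_one_sub P (a := fun c => 1 - hi c) (fun c _ => sub_nonneg.2 (hhi1 c)) fun c _ => sub_le_self _ (hhi0 c)
    have hb' : 1 - ∏ c ∈ P, (1 - hi c) ≤ ∑ c ∈ P, hi c := hb.trans (le_of_eq (Finset.sum_congr rfl fun c _ => by ring))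
    have hp1 : ∏ c ∈ S, lo c ≤ 1 := Finset.prod_le_one (fun c _ => hlo0 c) fun c _ => hlo1 c
    have hq1 : ∏ c ∈ P, (1 - hi c) ≤ 1 := Finset.prod_le_one (fun c _ => sub_nonneg.2 (hhi1 c)) fun c _ => sub_le_self _ (hhi0 c)
    have hab : 1 - G ≤ (1 - ∏ c ∈ S, lo c) + (1 - ∏ c ∈ P, (1 - hi c)) := by
      rw [hG]; nlinarith [mul_nonneg (sub_nonneg.2 hp1) (sub_nonneg.2 hq1)]
    linarith
  -- step 3: `T` absorbs one more of its own factors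
  have h3S : ∀ c ∈ S, T * (1 - lo c) ≤ T * (hi c - lo c) := by
    intro c hc
    have hTm : T * mid c = T := by
      rw [hT, ← Finset.mul_prod_erase S mid hc]
      calc mid c * (∏ x ∈ S.erase c, mid x) * (∏ x ∈ P, (1 - mid x)) * mid c
          = (mid c * mid c) * (∏ x ∈ S.erase c, mid x) * ∏ x ∈ P, (1 - mid x) := by ring
        _ = _ := by rw [hmid2 c]
    have hml : mid c * lo c = lo c := mul_eq_of_idem_of_le (hlo2 c) (hlm c) (hmid1 c)
    calc T * (1 - lo c) = T * mid c * (1 - lo c) := by rw [hTm]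
      _ = T * (mid c - lo c) := by rw [mul_assoc, mul_sub, mul_one, hml]
      _ ≤ T * (hi c - lo c) := mul_le_mul_of_nonneg_left (sub_le_sub_right (hmh c) _) hT0
  have h3P : ∀ c ∈ P, T * hi c ≤ T * (hi c - lo c) := by
    intro c hc
    have hTm : T * (1 - mid c) = T := by
      rw [hT, ← Finset.mul_prod_erase P (fun x => 1 - mid x) hc]
      have hsq : (1 - mid c) * (1 - mid c) = 1 - mid c := by nlinarith [hmid2 c]
      calc (∏ x ∈ S, mid x) * ((1 - mid c) * ∏ x ∈ P.erase c, (1 - mid x)) * (1 - mid c)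
          = (∏ x ∈ S, mid x) * (((1 - mid c) * (1 - mid c)) * ∏ x ∈ P.erase c, (1 - mid x)) := by ring
        _ = _ := by rw [hsq]
    have hhm : hi c * mid c = mid c := mul_eq_of_idem_of_le (hmid2 c) (hmh c) (hhi1 c)
    calc T * hi c = T * (1 - mid c) * hi c := by rw [hTm]
      _ = T * (hi c - mid c) := by rw [mul_assoc, sub_mul, one_mul, mul_comm (mid c), hhm]
      _ ≤ T * (hi c - lo c) := mul_le_mul_of_nonneg_left (sub_le_sub_left (hlm c) _) hT0
  -- step 4: assemble; `S`, `P` are disjoint parts of `univ`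
  have h5 : ∑ c ∈ S ∪ P, (hi c - lo c) ≤ ∑ c, (hi c - lo c) :=
    Finset.sum_le_sum_of_subset_of_nonneg (Finset.subset_univ _) fun c _ _ => sub_nonneg.2 ((hlm c).trans (hmh c))
  calc T - G ≤ T * (1 - G) := h1
    _ ≤ T * (∑ c ∈ S, (1 - lo c) + ∑ c ∈ P, hi c) := mul_le_mul_of_nonneg_left h2 hT0
    _ = ∑ c ∈ S, T * (1 - lo c) + ∑ c ∈ P, T * hi c := by rw [mul_add, Finset.mul_sum, Finset.mul_sum]
    _ ≤ ∑ c ∈ S, T * (hi c - lo c) + ∑ c ∈ P, T * (hi c - lo c) := add_le_add (Finset.sum_le_sum h3S) (Finset.sum_le_sum h3P)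
    _ = T * ∑ c ∈ S ∪ P, (hi c - lo c) := by rw [Finset.sum_union hSP, mul_add, Finset.mul_sum, Finset.mul_sum]
    _ ≤ T * ∑ c, (hi c - lo c) := mul_le_mul_of_nonneg_left h5 hT0
    _ = (∑ c, (hi c - lo c)) * T := mul_comm _ _

end Generic

/-! ## §30 The cover at NODE 00's (3.2) weights, label by label and through def-T's resummation -/

section Cover

variable (F : T4Family) (N : ℕ) [NeZero N] (ϑ : Stage9Params F N) (p : B12.RunParams) (g : ℕ → ℝ) (k : ℕ)

/-- ★ **THE (3.2)-LEVEL COVER**: `a|_θ(P) − aGap(θlo, θhi)(P) ≤ collar(θlo, θhi) · a|_θ(P)` for `θlo ≤ θ ≤ θhi` — §29 at the χ_{k+1}-cube factors of record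
(`{0,1}`-valued: def-T `chiFactorAt_mul_self`; monotone in the letter: `chiFactorAt_mono`; index sets `cubes32 s ∖ P` and `P`). [bookkeeping] -/
theorem aWeightAt_sub_aGapAt_le_collar_mul {θlo θ θhi : ℝ} (hlo : θlo ≤ θ) (hhi : θ ≤ θhi) (s : SeqOfRecord F ϑ.ν ϑ.τ9.M g p.K k)
    (Pl : Finset (Iχ F ϑ.ν p g k)) (V' : GaugeField (F.P p.K) (k + 1) (SU N)) :
    aWeightAt F N ϑ.ν ϑ.τ9.M p g k θ s Pl V' - aGapAt F N ϑ.ν ϑ.τ9.M p g k θlo θhi s Pl V' ≤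
      collarAt F N ϑ.ν p g k θlo θhi V' * aWeightAt F N ϑ.ν ϑ.τ9.M p g k θ s Pl V' := by
  by_cases hP : Pl ⊆ cubes32 F ϑ.ν ϑ.τ9.M p g k s
  · rw [aWeightAt_of_subset F N ϑ.ν ϑ.τ9.M p g k θ s hP, aGapAt_of_subset F N ϑ.ν ϑ.τ9.M p g k θlo θhi s hP]
    exact prod_sub_prod_gap_le_collar_mul (lo := fun c => chiFactorAt F N ϑ.ν p g k θlo c V') (mid := fun c => chiFactorAt F N ϑ.ν p g k θ c V')
      (hi := fun c => chiFactorAt F N ϑ.ν p g k θhi c V') Finset.sdiff_disjoint (fun c => chiFactorAt_nonneg F N ϑ.ν p g k θlo c V')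
      (fun c => chiFactorAt_mono F N ϑ.ν p g k hlo c V') (fun c => chiFactorAt_mono F N ϑ.ν p g k hhi c V')
      (fun c => chiFactorAt_le_one F N ϑ.ν p g k θhi c V') (fun c => chiFactorAt_mul_self F N ϑ.ν p g k θlo c V')
      (fun c => chiFactorAt_mul_self F N ϑ.ν p g k θ c V')
  · rw [aGapAt_of_not_subset F N ϑ.ν ϑ.τ9.M p g k θlo θhi s hP, aWeightAt, if_neg hP, sub_zero, mul_zero]

/-- ★★ **THE RESUMMED COVER, LOWER HALF**: at the top (`k + 1 = p.K`), for `θlo ≤ θ ≤ θhi` and `0 ≤ ζ`,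
`χ_{k+1}^{θlo}(s′)·wGap^{θlo,θhi}(s′)(U,V′) ≤ χ_{k+1}^{θ}(s′)·wTop^{θ}(s′)(U,V′)` — label by label after the two front-factor absorptions (`front_absorb_at`, `front_absorb_gap`):
`aGap(P) ≤ a|_θ(P)` times `b·ζ ≥ 0`. [bookkeeping] -/
theorem chi_mul_wGapAt_le_chi_mul_wTopAt (hk : k + 1 = p.K) (hζ0 : ∀ p g k s Pl Ql RS U V', 0 ≤ ϑ.ζ p g k s Pl Ql RS U V') {θlo θ θhi : ℝ}
    (hlo : θlo ≤ θ) (hhi : θ ≤ θhi) (s' : SeqOfRecord F ϑ.ν ϑ.τ9.M g p.K (k + 1)) (U : GaugeField (F.P p.K) k (SU N))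
    (V' : GaugeField (F.P p.K) (k + 1) (SU N)) :
    chiSeqOfRecordAt F N ϑ.ν ϑ.τ9.M g p.K (k + 1) θlo s' V' * wGapAt F N ϑ θlo θhi p g k s' U V' ≤
      chiSeqOfRecordAt F N ϑ.ν ϑ.τ9.M g p.K (k + 1) θ s' V' * wTopAt F N ϑ θ p g k s' U V' := by
  classical
  have htop : topLetter ϑ.ν θ p g (k + 1) = θ := by rw [hk]; exact topLetter_top ϑ.ν θ p g
  rw [wTopAt_apply, wGapAt_apply, htop]
  unfold resumWeights
  rw [Finset.mul_sum, Finset.mul_sum]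
  refine Finset.sum_le_sum fun t ht => ?_
  have hts : σOfRecord F ϑ.ν ϑ.τ9.M p g k s'.init t = s' := (Finset.mem_filter.1 ht).2
  rw [show chiSeqOfRecordAt F N ϑ.ν ϑ.τ9.M g p.K (k + 1) θlo s' V' = chiSeqOfRecordAt F N ϑ.ν ϑ.τ9.M g p.K (k + 1) θlo (σOfRecord F ϑ.ν ϑ.τ9.M p g k s'.init t) V' by
      rw [hts],
    show chiSeqOfRecordAt F N ϑ.ν ϑ.τ9.M g p.K (k + 1) θ s' V' = chiSeqOfRecordAt F N ϑ.ν ϑ.τ9.M g p.K (k + 1) θ (σOfRecord F ϑ.ν ϑ.τ9.M p g k s'.init t) V' by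
      rw [hts]]
  unfold ωGapAt ωOfRecordAt
  rw [← mul_assoc, ← mul_assoc, front_absorb_gap, ← mul_assoc, ← mul_assoc, front_absorb_at]
  exact mul_le_mul_of_nonneg_right (mul_le_mul_of_nonneg_right (aGapAt_le_aWeightAt F N ϑ.ν ϑ.τ9.M p g k hlo hhi _ _ _)
    (bWeightAt_nonneg F N ϑ.ν ϑ.τ9.M p g k _ _ _ _ _ _)) (hζ0 _ _ _ _ _ _ _ _ _)

/-- ★★ **THE RESUMMED COVER, UPPER HALF**: at the top, for `θlo ≤ θ ≤ θhi` and `0 ≤ ζ`,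
`χ^{θ}(s′)·wTop^{θ}(s′) − χ^{θlo}(s′)·wGap^{θlo,θhi}(s′) ≤ collar(θlo,θhi)(V′) · χ^{θ}(s′)·wTop^{θ}(s′)` pointwise in `(U, V′)` — label by label `a|_θ − aGap ≤ collar·a|_θ` times
`b·ζ ≥ 0`. [bookkeeping] -/
theorem chi_mul_wTopAt_sub_chi_mul_wGapAt_le_collar_mul (hk : k + 1 = p.K) (hζ0 : ∀ p g k s Pl Ql RS U V', 0 ≤ ϑ.ζ p g k s Pl Ql RS U V') {θlo θ θhi : ℝ}
    (hlo : θlo ≤ θ) (hhi : θ ≤ θhi) (s' : SeqOfRecord F ϑ.ν ϑ.τ9.M g p.K (k + 1)) (U : GaugeField (F.P p.K) k (SU N))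
    (V' : GaugeField (F.P p.K) (k + 1) (SU N)) :
    chiSeqOfRecordAt F N ϑ.ν ϑ.τ9.M g p.K (k + 1) θ s' V' * wTopAt F N ϑ θ p g k s' U V' -
        chiSeqOfRecordAt F N ϑ.ν ϑ.τ9.M g p.K (k + 1) θlo s' V' * wGapAt F N ϑ θlo θhi p g k s' U V' ≤
      collarAt F N ϑ.ν p g k θlo θhi V' * (chiSeqOfRecordAt F N ϑ.ν ϑ.τ9.M g p.K (k + 1) θ s' V' * wTopAt F N ϑ θ p g k s' U V') := by
  classical
  have htop : topLetter ϑ.ν θ p g (k + 1) = θ := by rw [hk]; exact topLetter_top ϑ.ν θ p g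
  rw [wTopAt_apply, wGapAt_apply, htop]
  unfold resumWeights
  rw [Finset.mul_sum, Finset.mul_sum, ← Finset.sum_sub_distrib, Finset.mul_sum]
  refine Finset.sum_le_sum fun t ht => ?_
  have hts : σOfRecord F ϑ.ν ϑ.τ9.M p g k s'.init t = s' := (Finset.mem_filter.1 ht).2
  rw [show chiSeqOfRecordAt F N ϑ.ν ϑ.τ9.M g p.K (k + 1) θlo s' V' = chiSeqOfRecordAt F N ϑ.ν ϑ.τ9.M g p.K (k + 1) θlo (σOfRecord F ϑ.ν ϑ.τ9.M p g k s'.init t) V' by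
      rw [hts],
    show chiSeqOfRecordAt F N ϑ.ν ϑ.τ9.M g p.K (k + 1) θ s' V' = chiSeqOfRecordAt F N ϑ.ν ϑ.τ9.M g p.K (k + 1) θ (σOfRecord F ϑ.ν ϑ.τ9.M p g k s'.init t) V' by
      rw [hts]]
  unfold ωGapAt ωOfRecordAt
  rw [← mul_assoc, ← mul_assoc, front_absorb_at, ← mul_assoc, ← mul_assoc, front_absorb_gap, ← sub_mul, ← sub_mul, ← mul_assoc, ← mul_assoc]
  exact mul_le_mul_of_nonneg_right (mul_le_mul_of_nonneg_right (aWeightAt_sub_aGapAt_le_collar_mul F N ϑ p g k hlo hhi _ _ _)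
    (bWeightAt_nonneg F N ϑ.ν ϑ.τ9.M p g k _ _ _ _ _ _)) (hζ0 _ _ _ _ _ _ _ _ _)

end Cover

/-! ## §31 The term, the gapped core and the shell ON THE GRAPH of the averaging of record -/

section Graph

variable (F : T4Family) (N : ℕ) [NeZero N] (ϑ : Stage9Params F N) (D : FiniteEpsData F (SU N)) (g₀ : ℕ → ℝ) (os : List (ULoop F))
  (p : B12.RunParams) (g : ℕ → ℝ) (k : ℕ)

/-- **A 𝐓-STEPPED SLOT TESTED AGAINST A BOUNDED MEASURABLE FUNCTION OF THE NEW FIELD LIVES ON THE GRAPH**: for `k < p.K`, jointly measurable step weights with `|w| ≤ 1` and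
an integrable old piece, `∫ φ(V′)·(𝐓-step Θ w)(s′)(V′) dV′ = ∫ (χ_k|_{Θ_k}·T)(init s′)(U) · φ(Ū)·w(s′)(U, Ū) dU` — def-T FILE 1's disintegration identity `integral_transport_piece` BY NAME.
[bookkeeping] -/
theorem integral_mul_tstepOfRecordAt_eq_graph (Θ : ThresholdLetter) (w : StepWeightsOfRecord F N ϑ.ν ϑ.τ9.M) (hk : k < p.K)
    (T : SeqOfRecord F ϑ.ν ϑ.τ9.M g p.K k → Density (F.P p.K) k (SU N)) (s' : SeqOfRecord F ϑ.ν ϑ.τ9.M g p.K (k + 1))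
    (hT : Integrable (fun U => chiSeqOfRecordAt F N ϑ.ν ϑ.τ9.M g p.K k (Θ p g k) s'.init U * T s'.init U) (fieldMeasure (F.P p.K) k (SU N)))
    (hw : Measurable (fun z : GaugeField (F.P p.K) (k + 1) (SU N) × GaugeField (F.P p.K) k (SU N) => w p g k s' z.2 z.1))
    (hwb : ∀ U V', |w p g k s' U V'| ≤ 1) {φ : GaugeField (F.P p.K) (k + 1) (SU N) → ℝ} (hφ : Measurable φ) {C : ℝ} (hφb : ∀ V, |φ V| ≤ C) :
    ∫ V, φ V * tstepOfRecordAt F N ϑ.ν ϑ.τ9.M Θ w p g k T s' V ∂fieldMeasure (F.P p.K) (k + 1) (SU N) =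
      ∫ U, (chiSeqOfRecordAt F N ϑ.ν ϑ.τ9.M g p.K k (Θ p g k) s'.init U * T s'.init U) *
        (φ ((avOfRecord F N p.K k).avg U) * w p g k s' U ((avOfRecord F N p.K k).avg U)) ∂fieldMeasure (F.P p.K) k (SU N) := by
  have hb : Measurable (fun z : GaugeField (F.P p.K) (k + 1) (SU N) × GaugeField (F.P p.K) k (SU N) => φ z.1 * w p g k s' z.2 z.1) :=
    (hφ.comp measurable_fst).mul hw
  have hbC : ∀ z : GaugeField (F.P p.K) (k + 1) (SU N) × GaugeField (F.P p.K) k (SU N), ‖φ z.1 * w p g k s' z.2 z.1‖ ≤ C := fun z => by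
    rw [Real.norm_eq_abs, abs_mul]
    exact (mul_le_of_le_one_right (abs_nonneg _) (hwb z.2 z.1)).trans (hφb z.1)
  have e : ∀ V, φ V * tstepOfRecordAt F N ϑ.ν ϑ.τ9.M Θ w p g k T s' V = (T4AveragingDisintegration.avgDensity (avOfRecord F N p.K k).avg V : ℝ) *
      ∫ U, (chiSeqOfRecordAt F N ϑ.ν ϑ.τ9.M g p.K k (Θ p g k) s'.init U * T s'.init U) *
        (fun z : GaugeField (F.P p.K) (k + 1) (SU N) × GaugeField (F.P p.K) k (SU N) => φ z.1 * w p g k s' z.2 z.1) (V, U)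
          ∂(T4AveragingDisintegration.avgKernel (avOfRecord F N p.K k).avg V) := by
    intro V
    rw [show tstepOfRecordAt F N ϑ.ν ϑ.τ9.M Θ w p g k T s' V = _ from texpASucc_apply _ _ _ _ s' V, mul_left_comm, ← integral_const_mul]
    exact congrArg _ (integral_congr_ae (ae_of_all _ fun U => by ring))
  rw [integral_congr_ae (ae_of_all _ e)]
  exact integral_transport_piece (avOfRecord_measurable F N p.K k) (avOfRecord_haarAC F N p.K k hk) hT hb hbC

/-- the old piece of a top history: `h(s′)(U) := χ_k(init s′)(U)·slot_k^{t}(init s′)(U)` is what F3's (e1) integrability speaks about; at the letter `topLetter ν θ` the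
level-`k` front factor IS the record's (`k < p.K`). [bookkeeping] -/
theorem integrable_oldPiece_topLetter (hk : k < p.K) (θ t : ℝ)
    (hint : ∀ s : SeqOfRecord F ϑ.ν ϑ.τ9.M g p.K k,
      Integrable (fun U => chiSeqOfRecord F N ϑ.ν ϑ.τ9.M g p.K k s U * dressedSlotsOfDatum₉ F N ϑ D g₀ os t p g k s U) (fieldMeasure (F.P p.K) k (SU N)))
    (s' : SeqOfRecord F ϑ.ν ϑ.τ9.M g p.K (k + 1)) :
    Integrable (fun U => chiSeqOfRecordAt F N ϑ.ν ϑ.τ9.M g p.K k (topLetter ϑ.ν θ p g k) s'.init U * dressedSlotsOfDatum₉ F N ϑ D g₀ os t p g k s'.init U)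
      (fieldMeasure (F.P p.K) k (SU N)) := by
  rw [chiSeqOfRecordAt_topLetter_of_lt F N ϑ p g k hk θ]
  exact hint s'.init

/-- **THE TOP-LETTERED TERM ON THE GRAPH**: `topClassWeight^{θ}(s′) = ∫ h(s′)(U) · χ_{k+1}^{θ}(s′)(Ū)·wTop^{θ}(s′)(U, Ū) dU` (rows: (H-ζ), `Σ|ζ| ≤ 1`, (e1) at level `k`).
[bookkeeping] -/
theorem topClassWeightAt_eq_graph (hk : k < p.K) (hζm : ZetaMeasurable F N ϑ.ζ) (hζ1 : IsZetaAbsLeOne F N ϑ.ν ϑ.τ9.M ϑ.ζ) (θ t : ℝ)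
    (hint : ∀ s : SeqOfRecord F ϑ.ν ϑ.τ9.M g p.K k,
      Integrable (fun U => chiSeqOfRecord F N ϑ.ν ϑ.τ9.M g p.K k s U * dressedSlotsOfDatum₉ F N ϑ D g₀ os t p g k s U) (fieldMeasure (F.P p.K) k (SU N)))
    (s' : SeqOfRecord F ϑ.ν ϑ.τ9.M g p.K (k + 1)) :
    topClassWeightAt F N ϑ D g₀ os p g k θ t s' =
      ∫ U, (chiSeqOfRecord F N ϑ.ν ϑ.τ9.M g p.K k s'.init U * dressedSlotsOfDatum₉ F N ϑ D g₀ os t p g k s'.init U) *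
        (chiSeqOfRecordAt F N ϑ.ν ϑ.τ9.M g p.K (k + 1) θ s' ((avOfRecord F N p.K k).avg U) * wTopAt F N ϑ θ p g k s' U ((avOfRecord F N p.K k).avg U))
          ∂fieldMeasure (F.P p.K) k (SU N) := by
  have h := integral_mul_tstepOfRecordAt_eq_graph F N ϑ p g k (topLetter ϑ.ν θ) (wTopAt F N ϑ θ) hk (dressedSlotsOfDatum₉ F N ϑ D g₀ os t p g k) s'
    (integrable_oldPiece_topLetter F N ϑ D g₀ os p g k hk θ t hint s') (measurable_wTopAt F N ϑ p g k hζm θ s') (abs_wTopAt_le_one F N ϑ p g k hζ1 θ s')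
    (measurable_chiSeqOfRecordAt_of_localBg (localBgMeasurable F N ϑ.ν) ϑ.τ9.M g p.K (k + 1) θ s')
    (fun V => abs_chiSeqOfRecordAt_le_one F N ϑ.ν ϑ.τ9.M g p.K (k + 1) θ s' V)
  rw [chiSeqOfRecordAt_topLetter_of_lt F N ϑ p g k hk θ] at h
  exact h

/-- **THE GAPPED CORE ON THE GRAPH**: `topGapCore^{θlo,θhi}(s′) = ∫ h(s′)(U) · χ_{k+1}^{θlo}(s′)(Ū)·wGap^{θlo,θhi}(s′)(U, Ū) dU` (rows: (H-ζ), `Σ|ζ| ≤ 1`, `θlo ≤ θhi`,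
(e1) at level `k`). [bookkeeping] -/
theorem topGapCoreAt_eq_graph (hk : k < p.K) (hζm : ZetaMeasurable F N ϑ.ζ) (hζ1 : IsZetaAbsLeOne F N ϑ.ν ϑ.τ9.M ϑ.ζ) {θlo θhi : ℝ} (hgap : θlo ≤ θhi) (t : ℝ)
    (hint : ∀ s : SeqOfRecord F ϑ.ν ϑ.τ9.M g p.K k,
      Integrable (fun U => chiSeqOfRecord F N ϑ.ν ϑ.τ9.M g p.K k s U * dressedSlotsOfDatum₉ F N ϑ D g₀ os t p g k s U) (fieldMeasure (F.P p.K) k (SU N)))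
    (s' : SeqOfRecord F ϑ.ν ϑ.τ9.M g p.K (k + 1)) :
    topGapCoreAt F N ϑ D g₀ os p g k θlo θhi t s' =
      ∫ U, (chiSeqOfRecord F N ϑ.ν ϑ.τ9.M g p.K k s'.init U * dressedSlotsOfDatum₉ F N ϑ D g₀ os t p g k s'.init U) *
        (chiSeqOfRecordAt F N ϑ.ν ϑ.τ9.M g p.K (k + 1) θlo s' ((avOfRecord F N p.K k).avg U) * wGapAt F N ϑ θlo θhi p g k s' U ((avOfRecord F N p.K k).avg U))
          ∂fieldMeasure (F.P p.K) k (SU N) := by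
  have h := integral_mul_tstepOfRecordAt_eq_graph F N ϑ p g k (topLetter ϑ.ν θlo) (wGapAt F N ϑ θlo θhi) hk (dressedSlotsOfDatum₉ F N ϑ D g₀ os t p g k) s'
    (integrable_oldPiece_topLetter F N ϑ D g₀ os p g k hk θlo t hint s') (measurable_wGapAt F N ϑ p g k hζm θlo θhi s')
    (abs_wGapAt_le_one F N ϑ p g k hζ1 hgap s') (measurable_chiSeqOfRecordAt_of_localBg (localBgMeasurable F N ϑ.ν) ϑ.τ9.M g p.K (k + 1) θlo s')
    (fun V => abs_chiSeqOfRecordAt_le_one F N ϑ.ν ϑ.τ9.M g p.K (k + 1) θlo s' V)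
  rw [chiSeqOfRecordAt_topLetter_of_lt F N ϑ p g k hk θlo] at h
  exact h

/-- graph-side integrability of an old piece times a bounded jointly measurable cofactor (def-T FILE 1 `integrable_graph_piece` at the averaging of record). [bookkeeping] -/
theorem integrable_oldPiece_mul_graph (t : ℝ)
    (hint : ∀ s : SeqOfRecord F ϑ.ν ϑ.τ9.M g p.K k,
      Integrable (fun U => chiSeqOfRecord F N ϑ.ν ϑ.τ9.M g p.K k s U * dressedSlotsOfDatum₉ F N ϑ D g₀ os t p g k s U) (fieldMeasure (F.P p.K) k (SU N)))
    (s' : SeqOfRecord F ϑ.ν ϑ.τ9.M g p.K (k + 1)) {b : GaugeField (F.P p.K) (k + 1) (SU N) × GaugeField (F.P p.K) k (SU N) → ℝ} (hb : Measurable b)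
    {C : ℝ} (hbC : ∀ z, ‖b z‖ ≤ C) :
    Integrable (fun U => (chiSeqOfRecord F N ϑ.ν ϑ.τ9.M g p.K k s'.init U * dressedSlotsOfDatum₉ F N ϑ D g₀ os t p g k s'.init U) *
      b ((avOfRecord F N p.K k).avg U, U)) (fieldMeasure (F.P p.K) k (SU N)) :=
  integrable_graph_piece (avOfRecord_measurable F N p.K k) (hint s'.init) hb hbC

/-- ★ **THE TWO-SIDED COLLAR SHELL ON THE GRAPH**: at the top, `gapShell^{θlo,θ,θhi}(s′) = ∫ h(s′)(U)·[χ^{θ}(s′)wTop^{θ}(s′) − χ^{θlo}(s′)wGap^{θlo,θhi}(s′)](U, Ū) dU`.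
[bookkeeping] -/
theorem topGapShellAt_eq_graph (hk : k + 1 = p.K) (hζm : ZetaMeasurable F N ϑ.ζ) (hζ1 : IsZetaAbsLeOne F N ϑ.ν ϑ.τ9.M ϑ.ζ) {θlo θ θhi : ℝ} (hlo : θlo ≤ θ)
    (hhi : θ ≤ θhi) (t : ℝ)
    (hint : ∀ s : SeqOfRecord F ϑ.ν ϑ.τ9.M g p.K k,
      Integrable (fun U => chiSeqOfRecord F N ϑ.ν ϑ.τ9.M g p.K k s U * dressedSlotsOfDatum₉ F N ϑ D g₀ os t p g k s U) (fieldMeasure (F.P p.K) k (SU N)))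
    (s' : SeqOfRecord F ϑ.ν ϑ.τ9.M g p.K (k + 1)) :
    topGapShellAt F N ϑ D g₀ os p g k θlo θ θhi t s' =
      ∫ U, (chiSeqOfRecord F N ϑ.ν ϑ.τ9.M g p.K k s'.init U * dressedSlotsOfDatum₉ F N ϑ D g₀ os t p g k s'.init U) *
        (chiSeqOfRecordAt F N ϑ.ν ϑ.τ9.M g p.K (k + 1) θ s' ((avOfRecord F N p.K k).avg U) * wTopAt F N ϑ θ p g k s' U ((avOfRecord F N p.K k).avg U) -
          chiSeqOfRecordAt F N ϑ.ν ϑ.τ9.M g p.K (k + 1) θlo s' ((avOfRecord F N p.K k).avg U) * wGapAt F N ϑ θlo θhi p g k s' U ((avOfRecord F N p.K k).avg U))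
          ∂fieldMeasure (F.P p.K) k (SU N) := by
  have hk' : k < p.K := by omega
  have hU : LocalBgMeasurable F N ϑ.ν := localBgMeasurable F N ϑ.ν
  have hIT := integrable_oldPiece_mul_graph F N ϑ D g₀ os p g k t hint s'
    (b := fun z => chiSeqOfRecordAt F N ϑ.ν ϑ.τ9.M g p.K (k + 1) θ s' z.1 * wTopAt F N ϑ θ p g k s' z.2 z.1)
    (((measurable_chiSeqOfRecordAt_of_localBg hU ϑ.τ9.M g p.K (k + 1) θ s').comp measurable_fst).mul (measurable_wTopAt F N ϑ p g k hζm θ s'))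
    (C := 1) (fun z => by
      rw [Real.norm_eq_abs, abs_mul]
      exact (mul_le_of_le_one_right (abs_nonneg _) (abs_wTopAt_le_one F N ϑ p g k hζ1 θ s' z.2 z.1)).trans
        (abs_chiSeqOfRecordAt_le_one F N ϑ.ν ϑ.τ9.M g p.K (k + 1) θ s' z.1))
  have hIG := integrable_oldPiece_mul_graph F N ϑ D g₀ os p g k t hint s'
    (b := fun z => chiSeqOfRecordAt F N ϑ.ν ϑ.τ9.M g p.K (k + 1) θlo s' z.1 * wGapAt F N ϑ θlo θhi p g k s' z.2 z.1)
    (((measurable_chiSeqOfRecordAt_of_localBg hU ϑ.τ9.M g p.K (k + 1) θlo s').comp measurable_fst).mul (measurable_wGapAt F N ϑ p g k hζm θlo θhi s'))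
    (C := 1) (fun z => by
      rw [Real.norm_eq_abs, abs_mul]
      exact (mul_le_of_le_one_right (abs_nonneg _) (abs_wGapAt_le_one F N ϑ p g k hζ1 (hlo.trans hhi) s' z.2 z.1)).trans
        (abs_chiSeqOfRecordAt_le_one F N ϑ.ν ϑ.τ9.M g p.K (k + 1) θlo s' z.1))
  rw [topGapShellAt, topClassWeightAt_eq_graph F N ϑ D g₀ os p g k hk' hζm hζ1 θ t hint s', topGapCoreAt_eq_graph F N ϑ D g₀ os p g k hk' hζm hζ1 (hlo.trans hhi) t hint s',
    ← integral_sub hIT hIG]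
  exact integral_congr_ae (ae_of_all _ fun U => by ring)

/-- ★ (R) **`0 ≤` THE TWO-SIDED COLLAR SHELL** (so, with the definition lane's `topGapShellAt_le_topClassWeightAt`, `0 ≤ shell ≤ term`): the graph integrand is `h ≥ 0` times the
resummed cover's lower half. Rows: the top `k + 1 = p.K`, `0 ≤ ζ`, `Σ|ζ| ≤ 1`, (H-ζ), `θlo ≤ θ ≤ θhi`, (e1) at level `k`. [bookkeeping] -/
theorem topGapShellAt_nonneg (hk : k + 1 = p.K) (hζ0 : ∀ p g k s Pl Ql RS U V', 0 ≤ ϑ.ζ p g k s Pl Ql RS U V') (hζm : ZetaMeasurable F N ϑ.ζ)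
    (hζ1 : IsZetaAbsLeOne F N ϑ.ν ϑ.τ9.M ϑ.ζ) {θlo θ θhi : ℝ} (hlo : θlo ≤ θ) (hhi : θ ≤ θhi) (t : ℝ)
    (hint : ∀ s : SeqOfRecord F ϑ.ν ϑ.τ9.M g p.K k,
      Integrable (fun U => chiSeqOfRecord F N ϑ.ν ϑ.τ9.M g p.K k s U * dressedSlotsOfDatum₉ F N ϑ D g₀ os t p g k s U) (fieldMeasure (F.P p.K) k (SU N)))
    (s' : SeqOfRecord F ϑ.ν ϑ.τ9.M g p.K (k + 1)) : 0 ≤ topGapShellAt F N ϑ D g₀ os p g k θlo θ θhi t s' := by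
  rw [topGapShellAt_eq_graph F N ϑ D g₀ os p g k hk hζm hζ1 hlo hhi t hint s']
  refine integral_nonneg fun U => mul_nonneg (mul_nonneg (chiSeqOfRecord_nonneg F N ϑ.ν ϑ.τ9.M g p.K k _ U)
    (dressedSlotsOfDatum₉_nonneg F N ϑ D g₀ os p g (wOfRecord₉_nonneg ϑ hζ0 p g) t k _ U)) (sub_nonneg.2 ?_)
  exact chi_mul_wGapAt_le_chi_mul_wTopAt F N ϑ p g k hk hζ0 hlo hhi s' U _

/-- ★ **THE SHELL IS DOMINATED ON THE GRAPH BY THE COLLAR COUNT TIMES THE TERM's INTEGRAND**: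
`gapShell(s′) ≤ ∫ h(s′)(U) · collar(θlo,θhi)(Ū) · χ^{θ}(s′)(Ū)·wTop^{θ}(s′)(U, Ū) dU`. [bookkeeping] -/
theorem topGapShellAt_le_graph_collar (hk : k + 1 = p.K) (hζ0 : ∀ p g k s Pl Ql RS U V', 0 ≤ ϑ.ζ p g k s Pl Ql RS U V') (hζm : ZetaMeasurable F N ϑ.ζ)
    (hζ1 : IsZetaAbsLeOne F N ϑ.ν ϑ.τ9.M ϑ.ζ) {θlo θ θhi : ℝ} (hlo : θlo ≤ θ) (hhi : θ ≤ θhi) (t : ℝ)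
    (hint : ∀ s : SeqOfRecord F ϑ.ν ϑ.τ9.M g p.K k,
      Integrable (fun U => chiSeqOfRecord F N ϑ.ν ϑ.τ9.M g p.K k s U * dressedSlotsOfDatum₉ F N ϑ D g₀ os t p g k s U) (fieldMeasure (F.P p.K) k (SU N)))
    (s' : SeqOfRecord F ϑ.ν ϑ.τ9.M g p.K (k + 1)) :
    topGapShellAt F N ϑ D g₀ os p g k θlo θ θhi t s' ≤
      ∫ U, (chiSeqOfRecord F N ϑ.ν ϑ.τ9.M g p.K k s'.init U * dressedSlotsOfDatum₉ F N ϑ D g₀ os t p g k s'.init U) *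
        (collarAt F N ϑ.ν p g k θlo θhi ((avOfRecord F N p.K k).avg U) *
          (chiSeqOfRecordAt F N ϑ.ν ϑ.τ9.M g p.K (k + 1) θ s' ((avOfRecord F N p.K k).avg U) * wTopAt F N ϑ θ p g k s' U ((avOfRecord F N p.K k).avg U)))
          ∂fieldMeasure (F.P p.K) k (SU N) := by
  have hU : LocalBgMeasurable F N ϑ.ν := localBgMeasurable F N ϑ.ν
  have hI := integrable_oldPiece_mul_graph F N ϑ D g₀ os p g k t hint s'
    (b := fun z => collarAt F N ϑ.ν p g k θlo θhi z.1 *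
      (chiSeqOfRecordAt F N ϑ.ν ϑ.τ9.M g p.K (k + 1) θ s' z.1 * wTopAt F N ϑ θ p g k s' z.2 z.1))
    (((measurable_collarAt F N ϑ.ν p g k θlo θhi).comp measurable_fst).mul
      ((((measurable_chiSeqOfRecordAt_of_localBg hU ϑ.τ9.M g p.K (k + 1) θ s').comp measurable_fst).mul (measurable_wTopAt F N ϑ p g k hζm θ s'))))
    (C := Fintype.card (Iχ F ϑ.ν p g k)) (fun z => by
      rw [Real.norm_eq_abs, abs_mul, abs_mul]
      calc |collarAt F N ϑ.ν p g k θlo θhi z.1| * (|chiSeqOfRecordAt F N ϑ.ν ϑ.τ9.M g p.K (k + 1) θ s' z.1| * |wTopAt F N ϑ θ p g k s' z.2 z.1|)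
          ≤ (Fintype.card (Iχ F ϑ.ν p g k) : ℝ) * (1 * 1) :=
            mul_le_mul (abs_collarAt_le_card F N ϑ.ν p g k θlo θhi z.1)
              (mul_le_mul (abs_chiSeqOfRecordAt_le_one F N ϑ.ν ϑ.τ9.M g p.K (k + 1) θ s' z.1) (abs_wTopAt_le_one F N ϑ p g k hζ1 θ s' z.2 z.1)
                (abs_nonneg _) zero_le_one)
              (mul_nonneg (abs_nonneg _) (abs_nonneg _)) (Nat.cast_nonneg _)
        _ = Fintype.card (Iχ F ϑ.ν p g k) := by ring)
  rw [topGapShellAt_eq_graph F N ϑ D g₀ os p g k hk hζm hζ1 hlo hhi t hint s']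
  refine integral_mono_of_nonneg (ae_of_all _ fun U => ?_) hI (ae_of_all _ fun U => ?_)
  · exact mul_nonneg (mul_nonneg (chiSeqOfRecord_nonneg F N ϑ.ν ϑ.τ9.M g p.K k _ U)
      (dressedSlotsOfDatum₉_nonneg F N ϑ D g₀ os p g (wOfRecord₉_nonneg ϑ hζ0 p g) t k _ U))
      (sub_nonneg.2 (chi_mul_wGapAt_le_chi_mul_wTopAt F N ϑ p g k hk hζ0 hlo hhi s' U _))
  · exact mul_le_mul_of_nonneg_left (chi_mul_wTopAt_sub_chi_mul_wGapAt_le_collar_mul F N ϑ p g k hk hζ0 hlo hhi s' U _)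
      (mul_nonneg (chiSeqOfRecord_nonneg F N ϑ.ν ϑ.τ9.M g p.K k _ U) (dressedSlotsOfDatum₉_nonneg F N ϑ D g₀ os p g (wOfRecord₉_nonneg ϑ hζ0 p g) t k _ U))

end Graph

end Summit.QuantumFields.YangMills.Theorems.N21ShellSplitOfRecord13CoPH

end
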